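import Literature.Computability.AlgebraicComplexity.KoiranPortierTavenas2015.SumOfProductsOfSparsePowers
import HarnessLib

/-!
# Koiran–Portier–Tavenas 2015, §3: Theorems 12 and 13, the "Moreover" clauses — REAL
# (possibly negative) exponents on an interval where every `f_j` is positive — and
# Corollaries 14–15 (PROVED)

P. Koiran, N. Portier, S. Tavenas, *A Wronskian approach to the real τ-conjecture*, J. Symbolic
Comput. **68**:2 (2015) 195–214 = arXiv:1205.1015 [KoiranPortierTavenas2015]; held text
`paper:arxiv-1205.1015` (corpus-tex chunks `p0006`–`p0008`). THEOREMS ONLY (0 definitions,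
0 named facts). Companion of `SumOfProductsOfSparsePowers.lean` (the first sentences of
Theorems 12–13: natural exponents, `Z_ℝ`), which it imports for the support-class calculus
(`sumClass_*`, Lemma 11's count `card_support_le_of_sumClass`), the reduction
`exists_linearIndependent_subfamily` and the closed-form estimates `KPT2015_thm_12_estimate` /
`KPT2015_thm_13_estimate`. Printed statements:

* **Theorem 12, "Moreover"** (p0006:L65–70): "Moreover, if `I` is a real interval such that for
  all `j`, `f_j(I) ⊆ ]0,+∞[` (which ensures `f` is defined on `I`), then the result is still true
  for real (possibly negative) powers `α_{i,j}`, i.e., `Z_I(f) ≤ 4ktm + 4(e(1+t))^{mk²/2}`"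
  (`f = Σ_{i=1}^{k} a_i Π_{j=1}^{m} f_j^{α_{i,j}}` non identically zero, `f_j` with at most `t`
  monomials) — `KPT2015_thm_12_real`.
* **Theorem 13, "Moreover"** (p0007:L71–72): "Moreover, if `I` is a real interval such that for all
  `j`, `f_j(I) ⊆ ℝ^{+*}` …, then the result is always true for real powers `α_i`, i.e.
  `Z_I(f) ≤ (1/3)k³md + 2kmd + k`" (`deg f_j ≤ d`) — `KPT2015_thm_13_real`.
* **Corollary 14** (p0007:L84–87, Avendaño's family): "Let
  `f = Σ_{i=1}^{k} c_i x^{α_i}(ax+b)^{β_i}`. Let `I` be the interval `{x ∈ ℝ | x > 0 ∧ ax+b > 0}`.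
  Then `Z_I(f) = O(k³)`" — `KPT2015_cor_14`, with the EXPLICIT constant of the printed proof,
  `Z_I(f) ≤ 2k³/3 + 5k`.
* **Corollary 15** (p0008:L1–4): "Let `f = Σ_{i=1}^{k} a_i Π_{j=1}^{m} (c_j x + d_j)^{α_{i,j}}`
  where the coefficients `a_i`, `c_j`, `d_j` and the exponents `α_{i,j}` are real numbers. On the
  interval `I = {x ∈ ℝ | ∀ j, c_j x + d_j > 0}` we have `Z_I(f) = O(mk³)`" — `KPT2015_cor_15`,
  explicit constant `k³m/3 + 2km + k` (Theorem 13 with `d = 1`).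

**Typed-vs-printed (honest scope).** (1) `f(x) = Σ_{i:ι} a_i · Π_{j:κ} (f_j(x))^{α i j}` with
REAL exponents `α : ι → κ → ℝ` (`Real.rpow`), `f_j ∈ ℝ[X]` evaluated at `x`; `k = |ι|`,
`m = |κ|`. (2) The interval: the print allows any real interval; typed, as the tree's Theorem 9
(`KPT2015_thm_9`) and Lemma 5 (`KPT2015_lemma_5`) on which the proof runs, for an OPEN interval,
rendered as an open preconnected `Δ ⊆ ℝ` on which every `f_j` is positive
(`∀ x ∈ Δ, ∀ j, 0 < f_j(x)`). `-- TODO(general form): non-open intervals I (zeros at a closed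
endpoint).` In Corollaries 14–15 the printed interval `{x | ∀ j, c_j x + d_j > 0}` IS open, so
they are typed exactly (as subsets of `ℝ` cut out by the printed strict inequalities). (3) "non
identically zero function" (on `I`) is `∃ x ∈ Δ, f x ≠ 0`; it is implicit in the printed
Corollaries 14–15 and explicit here (for `f ≡ 0` on a non-empty `I`, `Z_I(f) = ∞`). (4)
`Z_I(f)`, "the number of distinct real roots of `f` over `I`" (Def. 6), is
`Set.encard {x | x ∈ Δ ∧ f x = 0}`, and each statement produces a natural number `n` equal to it
with the printed real bound on `n`. (5) The `O(k³)` / `O(mk³)` of Corollaries 14–15 are typed as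
the explicit polynomials the proof yields (a strengthening in form only). (6) Theorem 13's first
sentence says "`α_i` are integers": negative integer exponents make `f` a rational function; on an
interval avoiding the zeros of the `f_j` this is the present real-exponent statement, and globally
the printed proof's multiplication by `Π_j f_j^{N}` reduces it to natural exponents (the sibling
file's `KPT2015_thm_13`).

**Proof** (the printed one — "In both cases (whether `α_{i,j}` are integer or real numbers), the
functions `g_i` are analytic in `I`", p0006:L76 — run in the analytic setting). The factorisation
of the Wronskian is proved for FUNCTIONS on `Δ`: one Leibniz step
`((Π_j f_j^{γ_j}) · Q)' = (Π_j f_j^{γ_j−1}) · Q⁺` (`hasDerivAt_prod_rpow_mul`, via Mathlib's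
`HasDerivAt.rpow_const` and `HasDerivAt.fun_finsetProd`), iterated along `Δ` with
`Filter.EventuallyEq.iteratedDeriv_eq` (`iteratedDeriv_prod_rpow_mul`); no padding
`Π_j f_j^{N+k}` of the exponents is needed, negative real exponents being harmless on
`{f_j > 0}`. Hence `W(g_1,…,g_s)(x) = c(x) · D_s(x)` on `Δ` with `c(x) ≠ 0` and `D_s` a
POLYNOMIAL with monomials in `E_{m·C(s,2), C(s,2)}` (`wronskian_rpow_factorisation`), so
`Z_Δ(W_s) ≤ 2·C(mt + mC(s,2) − 1, mC(s,2)) − 1` by the weak rule of signs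
(`encard_zeros_wronskian_rpow_le`; the printed extra term `Σ_j Z(f_j)` vanishes on `{f_j > 0}`),
resp. `≤ md·C(s,2)` (`encard_zeros_wronskian_rpow_le_of_degree`). The reduction to a linearly
independent sub-family is done in the space of functions `Δ → ℝ`; the Wronskians are not
identically zero on `Δ` by Lemma 5 (Bôcher, `KPT2015_lemma_5`, open connected `Δ`); Theorem 9
(`KPT2015_thm_9`) sums up (`encard_zeros_sum_prod_rpow_le_of_wronskian_bound`); the closed forms
are the sibling file's estimates.

Consumers / context: as for the sibling file (route texts `Theses/LacunarySymmetroid.lean` l.183,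
`RealTau.lean`, `SymmetroidDescartes.lean`, `KPlusLogSqLaw.lean` quote Theorem 12). Cell
`val-lit` (t14 g10, lead-lmr RULINGS #10/#10b; LADDER-VALIANT V1 literature, dictionary shelf).
Honest framing: a 2015 real-root bound becoming a tree theorem; census-neutral; not a rung;
nothing here bears on VP versus VNP.

## References

* [KoiranPortierTavenas2015] P. Koiran, N. Portier, S. Tavenas, *A Wronskian approach to the real
  τ-conjecture*, J. Symbolic Comput. 68 (2015) 195–214, doi:10.1016/j.jsc.2014.09.036,
  arXiv:1205.1015 — §3: Theorems 12–13 ("Moreover"), Corollaries 14–15 (held text p0006–p0008).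
* M. Avendaño, *The number of roots of a lacunary bivariate polynomial on a line*, J. Symbolic
  Comput. 44 (2009) 1280–1284 (the print's [Ave09], context of Cor. 14; cited in print only).
* T.-Y. Li, J. M. Rojas, X. Wang, *Counting real connected components of trinomial curve
  intersections and m-nomial hypersurfaces*, Discrete Comput. Geom. 30 (2003) 379–414 (the
  print's [LRW03], context of Cor. 15; cited in print only).
-/

noncomputable section

open Polynomial Finset
open scoped Topology

namespace Literature.Computability.AlgebraicComplexity.KoiranPortierTavenas2015

section Analytic

variable {κ : Type*} [Fintype κ] [DecidableEq κ]

/-- A real power of a polynomial is analytic where the polynomial is positive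
(`f^α = exp(α log f)` there). [folklore] -/
private theorem analyticAt_eval_rpow (q : ℝ[X]) (p : ℝ) {x : ℝ} (hx : 0 < q.eval x) :
    AnalyticAt ℝ (fun z => q.eval z ^ p) x := by
  have hq : AnalyticAt ℝ (fun z => q.eval z) x :=
    (AnalyticOnNhd.eval_polynomial (𝕜 := ℝ) q) x (Set.mem_univ x)
  have h : AnalyticAt ℝ (fun z => Real.exp (Real.log (q.eval z) * p)) x :=
    ((hq.log hx).mul analyticAt_const).rexp'
  refine h.congr ?_
  have hev : ∀ᶠ z in 𝓝 x, 0 < q.eval z := hq.continuousAt.eventually (lt_mem_nhds hx)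
  filter_upwards [hev] with z hz
  rw [Real.rpow_def_of_pos hz]

omit [DecidableEq κ] in
/-- `x ↦ b · Π_j f_j(x)^{β_j}` (real exponents) is analytic where every `f_j` is positive
(p0006:L76: "the functions `g_i` are analytic in `I`"). [cite: KoiranPortierTavenas2015, proof of
Thm. 12 (p0006:L76)] -/
theorem analyticAt_const_mul_prod_eval_rpow (f : κ → ℝ[X]) (b : ℝ) (β : κ → ℝ) {x : ℝ}
    (hx : ∀ j, 0 < (f j).eval x) :
    AnalyticAt ℝ (fun z => b * ∏ j, (f j).eval z ^ β j) x :=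
  analyticAt_const.mul
    (Finset.analyticAt_fun_prod univ fun j _ => analyticAt_eval_rpow (f j) (β j) (hx j))

/-- One Leibniz step, analytic version with REAL exponents (p0006:L78 – p0007:L9 with real `α`):
where every `f_j` is positive, `((Π_j f_j^{γ_j}) · Q)' = (Π_j f_j^{γ_j − 1}) · Q⁺` with
`Q⁺ = (Σ_j γ_j f_j' Π_{j'≠j} f_{j'}) · Q + (Π_j f_j) · Q'` a POLYNOMIAL whose support class moves
from `(d,e)` to `(d+m, e+1)` (`m = |κ|`); no padding of the exponents is needed since negative real
exponents are harmless on `{f_j > 0}`.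
[cite: KoiranPortierTavenas2015, proof of Thm. 12 (p0006:L73–p0007:L9, real exponents)] -/
theorem hasDerivAt_prod_rpow_mul (A : Finset ℕ) (f : κ → ℝ[X])
    (hfA : ∀ j, ∀ n ∈ (f j).support, n ∈ A) (γ : κ → ℝ) (Q : ℝ[X]) {d e : ℕ}
    (hQ : ∀ n ∈ Q.support, n + e ∈ (A.finsuppAntidiag d).image fun c => ∑ a ∈ A, c a * a) :
    ∃ Q' : ℝ[X], (∀ n ∈ Q'.support, n + (e + 1) ∈
        (A.finsuppAntidiag (d + Fintype.card κ)).image fun c => ∑ a ∈ A, c a * a) ∧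
      ∀ x : ℝ, (∀ j, 0 < (f j).eval x) →
        HasDerivAt (fun y => (∏ j, (f j).eval y ^ γ j) * Q.eval y)
          ((∏ j, (f j).eval x ^ (γ j - 1)) * Q'.eval x) x := by
  classical
  set D : ℝ[X] := ∑ j, C (γ j) * (∏ j' ∈ univ.erase j, f j') * derivative (f j) with hD
  refine ⟨D * Q + (∏ j, f j) * derivative Q, ?_, ?_⟩
  · -- the class of `Q⁺` (as in the sibling file's `derivative_prod_pow_succ_mul`)
    have hDcl : ∀ n ∈ D.support, n + 1 ∈
        (A.finsuppAntidiag (Fintype.card κ)).image fun c => ∑ a ∈ A, c a * a := by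
      rw [hD]
      refine sumClass_sum _ _ fun j _ => ?_
      have h1 : ∀ n ∈ (C (γ j) * ∏ j' ∈ univ.erase j, f j').support,
          n + 0 ∈ (A.finsuppAntidiag ((univ.erase j).card)).image fun c => ∑ a ∈ A, c a * a :=
        sumClass_C_mul _ (sumClass_prod (univ.erase j) f (fun _ => 1) (fun _ => 0)
          (fun j' _ => sumClass_of_support_subset (hfA j')) (by simp) (by simp))
      exact sumClass_mul h1 (sumClass_derivative (sumClass_of_support_subset (hfA j)) rfl)
        (by rw [Finset.card_erase_of_mem (mem_univ j), Finset.card_univ]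
            have := Fintype.card_pos_iff.mpr ⟨j⟩
            omega)
        (by simp)
    have hPi : ∀ n ∈ (∏ j, f j).support,
        n + 0 ∈ (A.finsuppAntidiag (Fintype.card κ)).image fun c => ∑ a ∈ A, c a * a :=
      sumClass_prod univ f (fun _ => 1) (fun _ => 0)
        (fun j' _ => sumClass_of_support_subset (hfA j')) (by simp) (by simp)
    exact sumClass_add (sumClass_mul hDcl hQ (by ring) (by ring))
      (sumClass_mul hPi (sumClass_derivative hQ rfl) (by ring) (by ring))
  · intro x hx
    have hprod : HasDerivAt (fun y => ∏ j, (f j).eval y ^ γ j)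
        (∑ j, (∏ j' ∈ univ.erase j, (f j').eval x ^ γ j') •
          ((f j).derivative.eval x * γ j * (f j).eval x ^ (γ j - 1))) x :=
      HasDerivAt.fun_finsetProd fun j _ =>
        (Polynomial.hasDerivAt (f j) x).rpow_const (Or.inl (hx j).ne')
    have hQd : HasDerivAt (fun y => Q.eval y) (Q.derivative.eval x) x := Polynomial.hasDerivAt Q x
    refine (hprod.fun_mul hQd).congr_deriv ?_
    -- the value of the derivative
    have hγ : ∀ j, (f j).eval x ^ γ j = (f j).eval x ^ (γ j - 1) * (f j).eval x := fun j => by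
      rw [Real.rpow_sub_one (hx j).ne', div_mul_cancel₀ _ (hx j).ne']
    have hterm : ∀ j, (∏ j' ∈ univ.erase j, (f j').eval x ^ γ j') •
        ((f j).derivative.eval x * γ j * (f j).eval x ^ (γ j - 1)) =
        (∏ j', (f j').eval x ^ (γ j' - 1)) *
          (γ j * (∏ j' ∈ univ.erase j, (f j').eval x) * (f j).derivative.eval x) := by
      intro j
      rw [smul_eq_mul, Finset.prod_congr rfl (fun j' _ => hγ j'), Finset.prod_mul_distrib,
        ← Finset.prod_erase_mul univ (fun j' => (f j').eval x ^ (γ j' - 1)) (mem_univ j)]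
      ring
    have hall : (∏ j, (f j).eval x ^ γ j) =
        (∏ j, (f j).eval x ^ (γ j - 1)) * ∏ j, (f j).eval x := by
      rw [← Finset.prod_mul_distrib]
      exact Finset.prod_congr rfl (fun j _ => hγ j)
    have hDx : D.eval x =
        ∑ j, γ j * (∏ j' ∈ univ.erase j, (f j').eval x) * (f j).derivative.eval x := by
      rw [hD, eval_finsetSum]
      refine Finset.sum_congr rfl fun j _ => ?_
      simp [eval_prod]
    rw [Finset.sum_congr rfl (fun j _ => hterm j), ← Finset.mul_sum, hall, eval_add, eval_mul,
      eval_mul, hDx, eval_prod]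
    ring

/-- Iterating the analytic Leibniz step on an open set where every `f_j` is positive:
`((Π_j f_j^{γ_j}) · Q)^{(r)}(x) = (Π_j f_j(x)^{γ_j − r}) · Q_r(x)` with `Q_r` of class
`(d + r·m, e + r)`. [cite: KoiranPortierTavenas2015, proof of Thm. 12 (p0007:L1–9, real
exponents)] -/
theorem iteratedDeriv_prod_rpow_mul (A : Finset ℕ) (f : κ → ℝ[X])
    (hfA : ∀ j, ∀ n ∈ (f j).support, n ∈ A) {Δ : Set ℝ} (hΔ : IsOpen Δ)
    (hpos : ∀ x ∈ Δ, ∀ j, 0 < (f j).eval x) (r : ℕ) :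
    ∀ (γ : κ → ℝ) (Q : ℝ[X]) (d e : ℕ),
      (∀ n ∈ Q.support, n + e ∈ (A.finsuppAntidiag d).image fun c => ∑ a ∈ A, c a * a) →
      ∃ Q' : ℝ[X], (∀ n ∈ Q'.support, n + (e + r) ∈
          (A.finsuppAntidiag (d + r * Fintype.card κ)).image fun c => ∑ a ∈ A, c a * a) ∧
        ∀ x ∈ Δ, iteratedDeriv r (fun y => (∏ j, (f j).eval y ^ γ j) * Q.eval y) x =
          (∏ j, (f j).eval x ^ (γ j - r)) * Q'.eval x := by
  induction r with
  | zero =>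
    intro γ Q d e hQ
    exact ⟨Q, by simpa using hQ, fun x _ => by simp⟩
  | succ r ih =>
    intro γ Q d e hQ
    obtain ⟨Q₁, hQ₁, h₁⟩ := hasDerivAt_prod_rpow_mul A f hfA γ Q hQ
    obtain ⟨Q₂, hQ₂, h₂⟩ := ih (fun j => γ j - 1) Q₁ (d + Fintype.card κ) (e + 1) hQ₁
    refine ⟨Q₂, ?_, fun x hx => ?_⟩
    · have hd : d + Fintype.card κ + r * Fintype.card κ = d + (r + 1) * Fintype.card κ := by ring
      have he : e + 1 + r = e + (r + 1) := by ring
      rw [← hd, ← he]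
      exact hQ₂
    · rw [iteratedDeriv_succ']
      have hev : deriv (fun y => (∏ j, (f j).eval y ^ γ j) * Q.eval y) =ᶠ[𝓝 x]
          fun y => (∏ j, (f j).eval y ^ (γ j - 1)) * Q₁.eval y := by
        filter_upwards [hΔ.mem_nhds hx] with y hy
        exact (h₁ y (hpos y hy)).deriv
      rw [hev.iteratedDeriv_eq, h₂ x hx]
      congr 1
      refine Finset.prod_congr rfl fun j _ => ?_
      congr 1
      push_cast
      ring

/-- **The Wronskian factorisation, real exponents** (p0007:L11–24 with real `α`): for
`F_u(y) = b_u · Π_j f_j(y)^{β_uj}` (`u < s`), on an open set where every `f_j` is positive,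
`W(F_0,…,F_{s−1})(x) = c(x) · D(x)` with `c(x) ≠ 0` (a product of real powers of the `f_j(x)`) and
`D` a POLYNOMIAL of class `(m·C(s,2), C(s,2))`.
[cite: KoiranPortierTavenas2015, proof of Thm. 12 (p0007:L11–30, real exponents)] -/
theorem wronskian_rpow_factorisation (A : Finset ℕ) (f : κ → ℝ[X])
    (hfA : ∀ j, ∀ n ∈ (f j).support, n ∈ A) {Δ : Set ℝ} (hΔ : IsOpen Δ)
    (hpos : ∀ x ∈ Δ, ∀ j, 0 < (f j).eval x) (s : ℕ) (b : ℕ → ℝ) (β : ℕ → κ → ℝ)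
    (F : ℕ → ℝ → ℝ) (hF : ∀ u < s, F u = fun y => b u * ∏ j, (f j).eval y ^ β u j) :
    ∃ D : ℝ[X], (∀ n ∈ D.support, n + s.choose 2 ∈
        (A.finsuppAntidiag (Fintype.card κ * s.choose 2)).image fun c => ∑ a ∈ A, c a * a) ∧
      ∀ x ∈ Δ, ∃ c : ℝ, c ≠ 0 ∧ wronskian F s x = c * D.eval x := by
  classical
  have hentry : ∀ u v : Fin s, ∃ Quv : ℝ[X], (∀ n ∈ Quv.support, n + (v : ℕ) ∈
      (A.finsuppAntidiag ((v : ℕ) * Fintype.card κ)).image fun c => ∑ a ∈ A, c a * a) ∧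
      ∀ x ∈ Δ, iteratedDeriv (v : ℕ) (F u) x =
        (∏ j, (f j).eval x ^ (β u j - (v : ℕ))) * Quv.eval x := by
    intro u v
    obtain ⟨Q', hQ', h'⟩ := iteratedDeriv_prod_rpow_mul A f hfA hΔ hpos v (β u) (C (b u)) 0 0
      (sumClass_C A (b u))
    refine ⟨Q', by simpa using hQ', fun x hx => ?_⟩
    rw [hF u u.2]
    have : (fun y => b u * ∏ j, (f j).eval y ^ β u j) =
        fun y => (∏ j, (f j).eval y ^ β u j) * (C (b u)).eval y := by
      funext y
      rw [eval_C]
      ring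
    rw [this]
    exact h' x hx
  choose Qm hQm hfac using hentry
  refine ⟨Matrix.det (Matrix.of fun v u : Fin s => Qm u v), ?_, fun x hx => ?_⟩
  · -- the class of `det (Qm u v)` (verbatim from the sibling file)
    rw [Matrix.det_apply]
    refine sumClass_sum _ _ fun σ _ => ?_
    have hsumσ : ∑ i : Fin s, ((σ i : Fin s) : ℕ) = s.choose 2 := by
      rw [Equiv.sum_comp σ (fun i : Fin s => (i : ℕ)), Fin.sum_univ_eq_sum_range (fun i => i) s,
        Finset.sum_range_id, Nat.choose_two_right]
    have hprod : ∀ n ∈ (∏ i : Fin s, (Matrix.of fun v u : Fin s => Qm u v) (σ i) i).support,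
        n + s.choose 2 ∈ (A.finsuppAntidiag (Fintype.card κ * s.choose 2)).image
          fun c => ∑ a ∈ A, c a * a := by
      refine sumClass_prod univ _ (fun i => ((σ i : Fin s) : ℕ) * Fintype.card κ)
        (fun i => ((σ i : Fin s) : ℕ)) (fun i _ => ?_) ?_ hsumσ
      · simpa only [Matrix.of_apply] using hQm i (σ i)
      · rw [← Finset.sum_mul, hsumσ, mul_comm]
    rcases Int.units_eq_one_or (Equiv.Perm.sign σ) with hσ | hσ
    · rw [hσ, one_smul]
      exact hprod
    · rw [hσ, Units.smul_def, Units.val_neg, Units.val_one, neg_smul, one_smul]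
      exact sumClass_neg hprod
  · have hfpos : ∀ j, 0 < (f j).eval x := hpos x hx
    refine ⟨(∏ u : Fin s, ∏ j, (f j).eval x ^ β u j) *
        ∏ v : Fin s, (∏ j, (f j).eval x) ^ (-((v : ℕ) : ℝ)), ?_, ?_⟩
    · refine mul_ne_zero (Finset.prod_ne_zero_iff.mpr fun u _ =>
        Finset.prod_ne_zero_iff.mpr fun j _ => (Real.rpow_pos_of_pos (hfpos j) _).ne') ?_
      exact Finset.prod_ne_zero_iff.mpr fun v _ =>
        (Real.rpow_pos_of_pos (Finset.prod_pos fun j _ => hfpos j) _).ne'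
    · unfold wronskian
      have hM : (Matrix.of fun r c : Fin s => iteratedDeriv r (F c) x) =
          Matrix.of fun v u : Fin s => (∏ j, (f j).eval x ^ β u j) *
            (Matrix.of fun v u : Fin s => (∏ j, (f j).eval x) ^ (-((v : ℕ) : ℝ)) *
              (Matrix.of fun v u : Fin s => (Qm u v).eval x) v u) v u := by
        ext v u
        simp only [Matrix.of_apply]
        rw [hfac u v x hx]
        have : (∏ j, (f j).eval x ^ (β u j - (v : ℕ))) =
            (∏ j, (f j).eval x ^ β u j) * (∏ j, (f j).eval x) ^ (-((v : ℕ) : ℝ)) := by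
          rw [← Real.finsetProd_rpow _ _ (fun j _ => (hfpos j).le), ← Finset.prod_mul_distrib]
          refine Finset.prod_congr rfl fun j _ => ?_
          rw [sub_eq_add_neg, Real.rpow_add (hfpos j)]
        rw [this, mul_assoc]
      rw [hM, Matrix.det_mul_row, Matrix.det_mul_column]
      have hdet : Matrix.det (Matrix.of fun v u : Fin s => (Qm u v).eval x) =
          (Matrix.det (Matrix.of fun v u : Fin s => Qm u v)).eval x := by
        rw [← Polynomial.coe_evalRingHom, RingHom.map_det]
        congr 1
      rw [hdet]
      ring

/-- Zeros of the Wronskian, real exponents (p0007:L18–30 and L49): on an open set where every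
`f_j` (at most `t` monomials each) is positive, if `W(F_0,…,F_{s−1})` does not vanish identically
there, it has at most `2·C(mt + mC(s,2) − 1, mC(s,2)) − 1` zeros there (the factor `Σ_j Z(f_j)` of
the printed bound is absent on `{f_j > 0}`; subtraction-free `ℕ` form).
[cite: KoiranPortierTavenas2015, proof of Thm. 12 (p0007:L18–30, real exponents)] -/
theorem encard_zeros_wronskian_rpow_le (f : κ → ℝ[X]) (t : ℕ)
    (ht : ∀ j, (f j).support.card ≤ t) {Δ : Set ℝ} (hΔ : IsOpen Δ)
    (hpos : ∀ x ∈ Δ, ∀ j, 0 < (f j).eval x) (s : ℕ) (b : ℕ → ℝ) (β : ℕ → κ → ℝ)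
    (F : ℕ → ℝ → ℝ) (hF : ∀ u < s, F u = fun y => b u * ∏ j, (f j).eval y ^ β u j)
    (hW : ∃ x ∈ Δ, wronskian F s x ≠ 0) :
    {x | x ∈ Δ ∧ wronskian F s x = 0}.encard ≤
      ((2 * ((Fintype.card κ * t + Fintype.card κ * s.choose 2 - 1).choose
        (Fintype.card κ * s.choose 2) - 1) + 1 : ℕ) : ℕ∞) := by
  classical
  set A : Finset ℕ := univ.biUnion fun j => (f j).support with hA
  have hfA : ∀ j, ∀ n ∈ (f j).support, n ∈ A :=
    fun j n hn => mem_biUnion.mpr ⟨j, mem_univ j, hn⟩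
  have hAcard : A.card ≤ Fintype.card κ * t :=
    card_biUnion_le.trans (by simpa using Finset.sum_le_sum fun j (_ : j ∈ univ) => ht j)
  obtain ⟨D, hD, hfacW⟩ := wronskian_rpow_factorisation A f hfA hΔ hpos s b β F hF
  have hD0 : D ≠ 0 := by
    rintro rfl
    obtain ⟨x, hx, hWx⟩ := hW
    obtain ⟨c, -, hc⟩ := hfacW x hx
    rw [hc, eval_zero, mul_zero] at hWx
    exact hWx rfl
  have hsub : {x | x ∈ Δ ∧ wronskian F s x = 0} ⊆ ↑D.roots.toFinset := by
    rintro x ⟨hx, hW0⟩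
    obtain ⟨c, hc, hcx⟩ := hfacW x hx
    rw [hcx] at hW0
    have := (mul_eq_zero.mp hW0).resolve_left hc
    simp [mem_roots hD0, this]
  calc {x | x ∈ Δ ∧ wronskian F s x = 0}.encard ≤ (↑D.roots.toFinset : Set ℝ).encard :=
        Set.encard_le_encard hsub
    _ = D.roots.toFinset.card := Set.encard_coe_eq_coe_finsetCard _
    _ ≤ _ := by
        have h1 := card_roots_toFinset_le_of_card_support hD0
        have h2 := card_support_le_of_sumClass hD hAcard
        exact_mod_cast h1.trans (by omega)

/-- Degree version of `encard_zeros_wronskian_rpow_le` (proof of Thm. 13, p0007:L75–78, real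
exponents): if every `f_j` has degree `≤ δ`, the non-identically-zero Wronskian has at most
`m·δ·C(s,2)` zeros on the open set where every `f_j` is positive.
[cite: KoiranPortierTavenas2015, proof of Thm. 13 (p0007:L75–78, real exponents)] -/
theorem encard_zeros_wronskian_rpow_le_of_degree (f : κ → ℝ[X]) (δ : ℕ)
    (hδ : ∀ j, (f j).natDegree ≤ δ) {Δ : Set ℝ} (hΔ : IsOpen Δ)
    (hpos : ∀ x ∈ Δ, ∀ j, 0 < (f j).eval x) (s : ℕ) (b : ℕ → ℝ) (β : ℕ → κ → ℝ)
    (F : ℕ → ℝ → ℝ) (hF : ∀ u < s, F u = fun y => b u * ∏ j, (f j).eval y ^ β u j)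
    (hW : ∃ x ∈ Δ, wronskian F s x ≠ 0) :
    {x | x ∈ Δ ∧ wronskian F s x = 0}.encard ≤ ((Fintype.card κ * δ * s.choose 2 : ℕ) : ℕ∞) := by
  classical
  set A : Finset ℕ := univ.biUnion fun j => (f j).support with hA
  have hfA : ∀ j, ∀ n ∈ (f j).support, n ∈ A :=
    fun j n hn => mem_biUnion.mpr ⟨j, mem_univ j, hn⟩
  have hAδ : ∀ a ∈ A, a ≤ δ := by
    intro a ha
    obtain ⟨j, -, hj⟩ := mem_biUnion.mp ha
    exact (le_natDegree_of_mem_supp a hj).trans (hδ j)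
  obtain ⟨D, hD, hfacW⟩ := wronskian_rpow_factorisation A f hfA hΔ hpos s b β F hF
  have hD0 : D ≠ 0 := by
    rintro rfl
    obtain ⟨x, hx, hWx⟩ := hW
    obtain ⟨c, -, hc⟩ := hfacW x hx
    rw [hc, eval_zero, mul_zero] at hWx
    exact hWx rfl
  have hsub : {x | x ∈ Δ ∧ wronskian F s x = 0} ⊆ ↑D.roots.toFinset := by
    rintro x ⟨hx, hW0⟩
    obtain ⟨c, hc, hcx⟩ := hfacW x hx
    rw [hcx] at hW0
    have := (mul_eq_zero.mp hW0).resolve_left hc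
    simp [mem_roots hD0, this]
  have hDdeg : D.natDegree ≤ Fintype.card κ * s.choose 2 * δ - s.choose 2 :=
    natDegree_le_of_sumClass hD hAδ
  calc {x | x ∈ Δ ∧ wronskian F s x = 0}.encard ≤ (↑D.roots.toFinset : Set ℝ).encard :=
        Set.encard_le_encard hsub
    _ = D.roots.toFinset.card := Set.encard_coe_eq_coe_finsetCard _
    _ ≤ _ := by
        have h1 : D.roots.toFinset.card ≤ D.natDegree :=
          (Multiset.toFinset_card_le _).trans (card_roots' D)
        exact_mod_cast h1.trans (hDdeg.trans (by rw [Nat.mul_right_comm]; omega))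

end Analytic

/-! ### The skeleton of the "Moreover" clauses (real exponents on an open interval)

As in the sibling file: pass to a linearly independent sub-family with non-zero coefficients —
here in the space of functions on `Δ` —, bound `Z_Δ(f)` by Theorem 9 (`KPT2015_thm_9`, open `Δ`),
the Wronskians being not identically zero on `Δ` by Lemma 5 (`KPT2015_lemma_5`), and bound the
zeros of each `W_s` on `Δ` by a given `Bf s`. No multiplication by `Π_j f_j^{N+k}` is needed. -/

/-- The skeleton of the "Moreover" clauses of Theorems 12 and 13: if, on the open preconnected
set `Δ` where every `f_j` is positive, every not-identically-zero Wronskian of `s` functions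
`y ↦ b_u Π_j f_j(y)^{β_uj}` (real `β`) has at most `Bf s` zeros, then
`f(x) = Σ_i a_i Π_j f_j(x)^{α_ij}` (real `α`, `f ≢ 0` on `Δ`, `k` terms) has at most
`k − 1 + 2 Σ_{s=1}^{k} Bf s` zeros on `Δ`.
[cite: KoiranPortierTavenas2015, proof of Thm. 12 (p0006:L72–78, p0007:L31–47, real exponents)] -/
theorem encard_zeros_sum_prod_rpow_le_of_wronskian_bound {ι κ : Type*} [Fintype ι] [Fintype κ]
    (f : κ → ℝ[X]) (a : ι → ℝ) (α : ι → κ → ℝ) {Δ : Set ℝ} (hΔ : IsOpen Δ)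
    (hΔc : IsPreconnected Δ) (hpos : ∀ x ∈ Δ, ∀ j, 0 < (f j).eval x)
    (hne : ∃ x ∈ Δ, ∑ i, a i * ∏ j, (f j).eval x ^ α i j ≠ 0) (Bf : ℕ → ℕ)
    (hBf : ∀ (s : ℕ) (b : ℕ → ℝ) (β : ℕ → κ → ℝ) (F : ℕ → ℝ → ℝ),
      (∀ u < s, F u = fun y => b u * ∏ j, (f j).eval y ^ β u j) →
      (∃ x ∈ Δ, wronskian F s x ≠ 0) →
      {x | x ∈ Δ ∧ wronskian F s x = 0}.encard ≤ (Bf s : ℕ∞)) :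
    {x | x ∈ Δ ∧ ∑ i, a i * ∏ j, (f j).eval x ^ α i j = 0}.encard ≤
      (((Fintype.card ι - 1) + 2 * ∑ s ∈ Icc 1 (Fintype.card ι), Bf s : ℕ) : ℕ∞) := by
  classical
  obtain ⟨x₀, hx₀, hne₀⟩ := hne
  set k := Fintype.card ι with hk
  have hk1 : 1 ≤ k := by
    rw [Nat.one_le_iff_ne_zero]
    intro h0
    haveI : IsEmpty ι := Fintype.card_eq_zero_iff.mp h0
    exact hne₀ (by simp)
  -- the functions on `Δ`
  set g : ι → (↥Δ → ℝ) := fun i z => ∏ j, (f j).eval (z : ℝ) ^ α i j with hg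
  have hw : ∑ i, a i • g i ≠ 0 := by
    intro h0
    have := congrFun h0 ⟨x₀, hx₀⟩
    simp only [Finset.sum_apply, Pi.smul_apply, smul_eq_mul, hg, Pi.zero_apply] at this
    exact hne₀ this
  obtain ⟨s₀, idx, c, hs₀, hs₀k, -, hc, hli, hsum⟩ := exists_linearIndependent_subfamily g a hw
  -- the `ℕ`-indexed family fed to Theorem 9
  set cc : ℕ → ℝ := fun n => if h : n < s₀ then c ⟨n, h⟩ else 0 with hcc
  set αα : ℕ → κ → ℝ := fun n => if h : n < s₀ then α (idx ⟨n, h⟩) else fun _ => 0 with hαα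
  set F : ℕ → ℝ → ℝ := fun n y => cc n * ∏ j, (f j).eval y ^ αα n j with hF
  have hFshape : ∀ s, ∀ u < s, F u = fun y => cc u * ∏ j, (f j).eval y ^ αα u j :=
    fun _ _ _ => rfl
  have hF_an : ∀ n < s₀, AnalyticOnNhd ℝ (F n) Δ := fun n _ x hx =>
    analyticAt_const_mul_prod_eval_rpow f (cc n) (αα n) (hpos x hx)
  have hF_lt : ∀ (n : Fin s₀) (y : ℝ), F n y = c n * ∏ j, (f j).eval y ^ α (idx n) j := by
    intro n y
    simp only [hF, hcc, hαα, dif_pos n.2, Fin.eta]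
  -- `Σ_{n<s₀} F n = f` on `Δ`
  have hsumF : ∀ y ∈ Δ, ∑ n ∈ Finset.range s₀, F n y = ∑ i, a i * ∏ j, (f j).eval y ^ α i j := by
    intro y hy
    have h1 := congrFun hsum ⟨y, hy⟩
    simp only [Finset.sum_apply, Pi.smul_apply, smul_eq_mul, hg] at h1
    rw [← h1, Finset.sum_range]
    exact Finset.sum_congr rfl fun n _ => hF_lt n y
  have hzeros : {x | x ∈ Δ ∧ ∑ i, a i * ∏ j, (f j).eval x ^ α i j = 0} =
      {x | x ∈ Δ ∧ ∑ n ∈ Finset.range s₀, F n x = 0} := by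
    ext x
    simp only [Set.mem_setOf_eq]
    constructor
    · rintro ⟨hx, h⟩
      exact ⟨hx, by rw [hsumF x hx]; exact h⟩
    · rintro ⟨hx, h⟩
      exact ⟨hx, by rw [← hsumF x hx]; exact h⟩
  -- the Wronskians are not identically zero on `Δ` (Lemma 5 and linear independence)
  have hWne : ∀ j', j' ≤ s₀ → ∃ x ∈ Δ, wronskian F j' x ≠ 0 := by
    intro j' hj'
    by_contra hall
    push Not at hall
    obtain ⟨a', ⟨i₀, hi₀, ha'⟩, hrel⟩ :=
      (KPT2015_lemma_5 j' F hΔ ⟨⟨x₀, hx₀⟩, hΔc⟩ fun i hi => hF_an i (by omega)).mpr hall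
    have hrel' : ∑ n : Fin s₀, (if (n : ℕ) < j' then a' n * c n else 0) • g (idx n) = 0 := by
      funext z
      simp only [Finset.sum_apply, Pi.smul_apply, smul_eq_mul, Pi.zero_apply, hg]
      calc ∑ n : Fin s₀, (if (n : ℕ) < j' then a' n * c n else 0) *
            ∏ j, (f j).eval (z : ℝ) ^ α (idx n) j
          = ∑ i ∈ Finset.range s₀, (if i < j' then a' i * F i z else 0) := by
            rw [Finset.sum_range]
            refine Finset.sum_congr rfl fun n _ => ?_
            split_ifs with h
            · rw [hF_lt n z]
              ring
            · simp
        _ = ∑ i ∈ Finset.range j', a' i * F i z := by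
            rw [← Finset.sum_filter]
            congr 1
            ext i
            simp only [Finset.mem_filter, Finset.mem_range]
            omega
        _ = 0 := hrel z z.2
    have hzero := (Fintype.linearIndependent_iff.mp hli) _ hrel' ⟨i₀, by omega⟩
    simp only [hi₀, if_true] at hzero
    exact ha' ((mul_eq_zero.mp hzero).resolve_right (hc _))
  -- zero counts of the Wronskians
  set Bf0 : ℕ → ℕ := fun j => if j = 0 then 0 else Bf j with hBf0
  have hWle : ∀ j', j' ≤ s₀ →
      {x | x ∈ Δ ∧ wronskian F j' x = 0}.encard ≤ (Bf0 j' : ℕ∞) := by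
    intro j' hj'
    rcases Nat.eq_zero_or_pos j' with h0 | hpos'
    · subst h0
      have : {x | x ∈ Δ ∧ wronskian F 0 x = 0} = ∅ := by
        ext x
        simp [wronskian_zero]
      rw [this, Set.encard_empty]
      exact bot_le
    · have hB : Bf0 j' = Bf j' := by simp [hBf0, hpos'.ne']
      rw [hB]
      exact hBf j' cc αα F (hFshape j') (hWne j' hj')
  -- Theorem 9 on `Δ`
  have h9 := KPT2015_thm_9 s₀ hs₀ F hΔ hΔc hF_an
  rw [hzeros]
  refine h9.trans ?_
  have hnat : (s₀ - 1) + Bf0 s₀ + Bf0 (s₀ - 1) + 2 * ∑ j ∈ Icc 1 (s₀ - 2), Bf0 j ≤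
      (k - 1) + 2 * ∑ s ∈ Icc 1 k, Bf s := by
    have hIcc : ∀ b, ∑ j ∈ Icc 1 b, Bf0 j = ∑ j ∈ Icc 1 b, Bf j := by
      intro b
      refine Finset.sum_congr rfl fun j hj => ?_
      simp only [Finset.mem_Icc] at hj
      simp [hBf0, show j ≠ 0 by omega]
    have hmain : (s₀ - 1) + Bf0 s₀ + Bf0 (s₀ - 1) + 2 * ∑ j ∈ Icc 1 (s₀ - 2), Bf0 j ≤
        (s₀ - 1) + 2 * ∑ j ∈ Icc 1 s₀, Bf j := by
      rw [hIcc]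
      rcases Nat.lt_or_ge s₀ 2 with h2 | h2
      · obtain rfl : s₀ = 1 := by omega
        simp [hBf0]
        omega
      · have hsplit : ∑ j ∈ Icc 1 s₀, Bf j =
            (∑ j ∈ Icc 1 (s₀ - 2), Bf j) + Bf (s₀ - 1) + Bf s₀ := by
          obtain ⟨r, rfl⟩ : ∃ r, s₀ = r + 2 := ⟨s₀ - 2, by omega⟩
          rw [Finset.sum_Icc_succ_top (by omega), Finset.sum_Icc_succ_top (by omega)]
          simp only [Nat.add_sub_cancel, show r + 2 - 1 = r + 1 from rfl]
        have hB1 : Bf0 s₀ = Bf s₀ := by simp [hBf0, show s₀ ≠ 0 by omega]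
        have hB2 : Bf0 (s₀ - 1) = Bf (s₀ - 1) := by simp [hBf0, show s₀ - 1 ≠ 0 by omega]
        rw [hsplit, hB1, hB2]
        omega
    calc _ ≤ (s₀ - 1) + 2 * ∑ j ∈ Icc 1 s₀, Bf j := hmain
      _ ≤ (k - 1) + 2 * ∑ j ∈ Icc 1 k, Bf j := by
        gcongr ?_ + 2 * ?_
        · omega
        · exact Finset.sum_le_sum_of_subset (Finset.Icc_subset_Icc_right hs₀k)
  calc ((s₀ - 1 : ℕ) : ℕ∞) + {y | y ∈ Δ ∧ wronskian F s₀ y = 0}.encard +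
        {y | y ∈ Δ ∧ wronskian F (s₀ - 1) y = 0}.encard +
        2 * ∑ j ∈ Finset.Icc 1 (s₀ - 2), {y | y ∈ Δ ∧ wronskian F j y = 0}.encard
      ≤ ((s₀ - 1 : ℕ) : ℕ∞) + (Bf0 s₀ : ℕ∞) + (Bf0 (s₀ - 1) : ℕ∞) +
        2 * ∑ j ∈ Finset.Icc 1 (s₀ - 2), (Bf0 j : ℕ∞) := by
        gcongr with j hj
        · exact hWle s₀ le_rfl
        · exact hWle (s₀ - 1) (by omega)
        · simp only [Finset.mem_Icc] at hj
          exact hWle j (by omega)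
    _ = (((s₀ - 1) + Bf0 s₀ + Bf0 (s₀ - 1) + 2 * ∑ j ∈ Icc 1 (s₀ - 2), Bf0 j : ℕ) : ℕ∞) := by
        push_cast
        rfl
    _ ≤ _ := by exact_mod_cast hnat

/-! ### Theorem 12, "Moreover" -/

/-- **KPT 2015, Theorem 12, the "Moreover" clause** (p0006:L65–70): "Moreover, if `I` is a real
interval such that for all `j`, `f_j(I) ⊆ ]0,+∞[` (which ensures `f` is defined on `I`), then the
result is still true for real (possibly negative) powers `α_{i,j}`, i.e.,
`Z_I(f) ≤ 4ktm + 4(e(1+t))^{mk²/2}`." Typed for `f(x) = Σ_{i:ι} a_i Π_{j:κ} f_j(x)^{α i j}` with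
REAL exponents `α : ι → κ → ℝ` (`Real.rpow`), `f_j ∈ ℝ[X]` with `|supp f_j| ≤ t`, an OPEN interval
`I` (rendered as an open preconnected `Δ ⊆ ℝ`, the setting of the tree's Theorem 9 / Lemma 5) on
which every `f_j` is positive, "non identically zero" = `∃ x ∈ Δ, f x ≠ 0`, and
`Z_I(f) = encard {x ∈ Δ | f x = 0}` — a natural number `n` with the printed bound.
-- TODO(general form): non-open intervals `I` (zeros at a closed endpoint).
[cite: KoiranPortierTavenas2015, Thm. 12 ("Moreover")] -/
theorem KPT2015_thm_12_real {ι κ : Type*} [Fintype ι] [Fintype κ]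
    (f : κ → ℝ[X]) (t : ℕ) (ht : ∀ j, (f j).support.card ≤ t) (a : ι → ℝ) (α : ι → κ → ℝ)
    {Δ : Set ℝ} (hΔ : IsOpen Δ) (hΔc : IsPreconnected Δ)
    (hpos : ∀ x ∈ Δ, ∀ j, 0 < (f j).eval x)
    (hne : ∃ x ∈ Δ, ∑ i, a i * ∏ j, (f j).eval x ^ α i j ≠ 0) :
    ∃ n : ℕ, {x | x ∈ Δ ∧ ∑ i, a i * ∏ j, (f j).eval x ^ α i j = 0}.encard = n ∧
      (n : ℝ) ≤ 4 * Fintype.card ι * t * Fintype.card κ +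
        4 * (Real.exp 1 * (1 + t)) ^ ((Fintype.card κ * Fintype.card ι ^ 2 : ℝ) / 2) := by
  classical
  obtain ⟨x₀, hx₀, hne₀⟩ := hne
  have hk1 : 1 ≤ Fintype.card ι := by
    rw [Nat.one_le_iff_ne_zero]
    intro h0
    haveI : IsEmpty ι := Fintype.card_eq_zero_iff.mp h0
    exact hne₀ (by simp)
  rcases isEmpty_or_nonempty κ with hκ | hκ
  · -- no `f_j`: `f` is the non-zero constant `Σ_i a_i`
    have hempty : {x | x ∈ Δ ∧ ∑ i, a i * ∏ j, (f j).eval x ^ α i j = 0} = ∅ := by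
      ext x
      simp only [Finset.univ_eq_empty, Finset.prod_empty, mul_one, Set.mem_setOf_eq,
        Set.mem_empty_iff_false, iff_false, not_and]
      intro _ h
      apply hne₀
      simpa using h
    refine ⟨0, by rw [hempty, Set.encard_empty, Nat.cast_zero], ?_⟩
    rw [Nat.cast_zero]
    positivity
  · have hm1 : 1 ≤ Fintype.card κ := Fintype.card_pos
    have ht1 : 1 ≤ t := by
      obtain ⟨j⟩ := hκ
      have hfj : f j ≠ 0 := by
        intro h0
        have := hpos x₀ hx₀ j
        rw [h0, eval_zero] at this
        exact lt_irrefl _ this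
      have h1 := ht j
      have hp : 0 < (f j).support.card := Finset.card_pos.mpr (Polynomial.support_nonempty.mpr hfj)
      omega
    have hbound := encard_zeros_sum_prod_rpow_le_of_wronskian_bound f a α hΔ hΔc hpos
      ⟨x₀, hx₀, hne₀⟩
      (fun s => Fintype.card κ * (2 * (t - 1) + 1) +
        (2 * ((Fintype.card κ * t + Fintype.card κ * s.choose 2 - 1).choose
          (Fintype.card κ * s.choose 2) - 1) + 1))
      (fun s b β F hF hW => (encard_zeros_wronskian_rpow_le f t ht hΔ hpos s b β F hF hW).trans
        (by exact_mod_cast Nat.le_add_left _ _))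
    have hfin : {x | x ∈ Δ ∧ ∑ i, a i * ∏ j, (f j).eval x ^ α i j = 0}.encard ≠ ⊤ :=
      ne_top_of_le_ne_top (ENat.coe_ne_top _) hbound
    refine ⟨_, (ENat.coe_toNat hfin).symm, ?_⟩
    have h1 := ENat.toNat_le_of_le_coe hbound
    have h2 := KPT2015_thm_12_estimate (Fintype.card ι) (Fintype.card κ) t hk1 hm1 ht1
    exact (Nat.cast_le.mpr h1).trans h2

/-! ### Theorem 13, "Moreover" -/

/-- **KPT 2015, Theorem 13, the "Moreover" clause** (p0007:L71–72): "Moreover, if `I` is a real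
interval such that for all `j`, `f_j(I) ⊆ ℝ^{+*}` (which ensures `f` is defined on `I`), then the
result is always true for real powers `α_i`, i.e. `Z_I(f) ≤ (1/3)k³md + 2kmd + k`." Typed as
`KPT2015_thm_12_real` (real exponents, open preconnected `Δ` on which every `f_j` is positive,
`deg f_j ≤ d`). -- TODO(general form): non-open intervals `I`.
[cite: KoiranPortierTavenas2015, Thm. 13 ("Moreover")] -/
theorem KPT2015_thm_13_real {ι κ : Type*} [Fintype ι] [Fintype κ]
    (f : κ → ℝ[X]) (d : ℕ) (hd : ∀ j, (f j).natDegree ≤ d) (a : ι → ℝ) (α : ι → κ → ℝ)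
    {Δ : Set ℝ} (hΔ : IsOpen Δ) (hΔc : IsPreconnected Δ)
    (hpos : ∀ x ∈ Δ, ∀ j, 0 < (f j).eval x)
    (hne : ∃ x ∈ Δ, ∑ i, a i * ∏ j, (f j).eval x ^ α i j ≠ 0) :
    ∃ n : ℕ, {x | x ∈ Δ ∧ ∑ i, a i * ∏ j, (f j).eval x ^ α i j = 0}.encard = n ∧
      (n : ℝ) ≤ (Fintype.card ι : ℝ) ^ 3 * Fintype.card κ * d / 3 +
        2 * Fintype.card ι * Fintype.card κ * d + Fintype.card ι := by
  classical
  have hbound := encard_zeros_sum_prod_rpow_le_of_wronskian_bound f a α hΔ hΔc hpos hne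
    (fun s => Fintype.card κ * d + Fintype.card κ * d * s.choose 2)
    (fun s b β F hF hW => (encard_zeros_wronskian_rpow_le_of_degree f d hd hΔ hpos s b β F hF
      hW).trans (by exact_mod_cast Nat.le_add_left _ _))
  have hfin : {x | x ∈ Δ ∧ ∑ i, a i * ∏ j, (f j).eval x ^ α i j = 0}.encard ≠ ⊤ :=
    ne_top_of_le_ne_top (ENat.coe_ne_top _) hbound
  refine ⟨_, (ENat.coe_toNat hfin).symm, ?_⟩
  have h1 := ENat.toNat_le_of_le_coe hbound
  have h2 := KPT2015_thm_13_estimate (Fintype.card ι) (Fintype.card κ) d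
  exact (Nat.cast_le.mpr h1).trans h2

/-! ### Corollaries 14 and 15 (Avendaño's family; Li–Rojas–Wang) -/

/-- **KPT 2015, Corollary 15** (p0008:L1–4): "Let
`f = Σ_{i=1}^k a_i Π_{j=1}^m (c_j x + d_j)^{α_{i,j}}` where the coefficients `a_i`, `c_j`, `d_j`
and the exponents `α_{i,j}` are real numbers. On the
interval `I = {x ∈ ℝ | ∀ j, c_j x + d_j > 0}` we have `Z_I(f) = O(mk³)`." Typed with the
EXPLICIT constant the printed proof gives (Theorem 13 "Moreover" with `d = 1`):
`Z_I(f) ≤ k³m/3 + 2km + k`, for `f` not identically zero on `I` (as in Theorems 12–13; for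
`f ≡ 0` on a non-empty `I` the count is infinite). [cite: KoiranPortierTavenas2015, Cor. 15] -/
theorem KPT2015_cor_15 {ι κ : Type*} [Fintype ι] [Fintype κ] (a : ι → ℝ) (c d : κ → ℝ)
    (α : ι → κ → ℝ)
    (hne : ∃ x : ℝ, (∀ j, 0 < c j * x + d j) ∧ ∑ i, a i * ∏ j, (c j * x + d j) ^ α i j ≠ 0) :
    ∃ n : ℕ, {x | (∀ j, 0 < c j * x + d j) ∧
        ∑ i, a i * ∏ j, (c j * x + d j) ^ α i j = 0}.encard = n ∧
      (n : ℝ) ≤ (Fintype.card ι : ℝ) ^ 3 * Fintype.card κ / 3 +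
        2 * Fintype.card ι * Fintype.card κ + Fintype.card ι := by
  classical
  set Δ : Set ℝ := {x | ∀ j, 0 < c j * x + d j} with hΔdef
  set f : κ → ℝ[X] := fun j => C (c j) * X + C (d j) with hfdef
  have hfeval : ∀ j x, (f j).eval x = c j * x + d j := fun j x => by simp [hfdef]
  have hΔo : IsOpen Δ := by
    rw [hΔdef, Set.setOf_forall]
    exact isOpen_iInter_of_finite fun j => isOpen_lt continuous_const (by fun_prop)
  have hΔc : IsPreconnected Δ := by
    apply Set.OrdConnected.isPreconnected
    refine ⟨fun x hx y hy z hz j => ?_⟩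
    have h1 := hx j
    have h2 := hy j
    have hz1 := hz.1
    have hz2 := hz.2
    rcases le_or_gt 0 (c j) with hc | hc
    · nlinarith
    · nlinarith
  have hpos : ∀ x ∈ Δ, ∀ j, 0 < (f j).eval x := fun x hx j => by
    rw [hfeval]
    exact hx j
  have hdeg : ∀ j, (f j).natDegree ≤ 1 := fun j => natDegree_linear_le
  have hne' : ∃ x ∈ Δ, ∑ i, a i * ∏ j, (f j).eval x ^ α i j ≠ 0 := by
    obtain ⟨x, hx, h⟩ := hne
    exact ⟨x, hx, by simpa only [hfeval] using h⟩
  obtain ⟨n, hn, hle⟩ := KPT2015_thm_13_real f 1 hdeg a α hΔo hΔc hpos hne'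
  refine ⟨n, ?_, by simpa using hle⟩
  rw [← hn]
  simp only [hfeval, hΔdef, Set.mem_setOf_eq]

/-- **KPT 2015, Corollary 14** (p0007:L84–87): "Let `f = Σ_{i=1}^k c_i x^{α_i} (ax+b)^{β_i}`. Let
`I` be the interval `{x ∈ ℝ | x > 0 ∧ ax + b > 0}`. Then `Z_I(f) = O(k³)`" (Avendaño's family,
with REAL exponents `α_i, β_i` — "a polynomial bound but which works also for real powers").
Typed with the EXPLICIT constant of the proof (Corollary 15 with `m = 2`): `Z_I(f) ≤ 2k³/3 + 5k`,
for `f` not identically zero on `I`. [cite: KoiranPortierTavenas2015, Cor. 14] -/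
theorem KPT2015_cor_14 {ι : Type*} [Fintype ι] (c : ι → ℝ) (α β : ι → ℝ) (a b : ℝ)
    (hne : ∃ x : ℝ, 0 < x ∧ 0 < a * x + b ∧ ∑ i, c i * (x ^ α i * (a * x + b) ^ β i) ≠ 0) :
    ∃ n : ℕ, {x | 0 < x ∧ 0 < a * x + b ∧
        ∑ i, c i * (x ^ α i * (a * x + b) ^ β i) = 0}.encard = n ∧
      (n : ℝ) ≤ 2 * (Fintype.card ι : ℝ) ^ 3 / 3 + 5 * Fintype.card ι := by
  have hform : ∀ x : ℝ, (∀ j : Fin 2, 0 < ![(1 : ℝ), a] j * x + ![(0 : ℝ), b] j) ↔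
      (0 < x ∧ 0 < a * x + b) := fun x => by
    simp [Fin.forall_fin_two]
  have hprod : ∀ (x : ℝ) (i : ι), ∏ j : Fin 2, (![(1 : ℝ), a] j * x + ![(0 : ℝ), b] j) ^
      (![α i, β i] : Fin 2 → ℝ) j = x ^ α i * (a * x + b) ^ β i := fun x i => by
    simp [Fin.prod_univ_two]
  obtain ⟨n, hn, hle⟩ := KPT2015_cor_15 (κ := Fin 2) c ![(1 : ℝ), a] ![(0 : ℝ), b]
    (fun i => ![α i, β i]) (by
      obtain ⟨x, hx0, hx1, h⟩ := hne
      exact ⟨x, (hform x).mpr ⟨hx0, hx1⟩, by simpa only [hprod] using h⟩)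
  refine ⟨n, ?_, ?_⟩
  · rw [← hn]
    congr 1
    ext x
    simp only [Set.mem_setOf_eq, hprod, hform, and_assoc]
  · simp only [Fintype.card_fin, Nat.cast_ofNat] at hle
    linarith

end Literature.Computability.AlgebraicComplexity.KoiranPortierTavenas2015
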